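import Mathlib
import Summits.AnomalousDissipation.AnomalousDissipation.Theorems.MarginalStabilityChainStretchedVortexRowsStubRowVorticityConstructionToolsStream

/-!
# Stub `stub_rowVorticityConstruction` (crux stmt-AnomalousDissipation-3009) — tools IX:
# double integration by parts along lines and over periods (Green's second identity on the strip, 1-D pieces)

Helper file (supports stmt-AnomalousDissipation-3009). Second brick of the Poisson equation `ΔΨ = 4πω` for the
cylinder stream integral: for a SMOOTH kernel (the regularised `Φ_ε` of tools VIII) Green's second identity
`∫_{S_L} Φ_ε(q) (Δω)(p − q) dq = ∫_{S_L} (ΔΦ_ε)(q) ω(p − q) dq` splits, by Fubini, into one-dimensional double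
integrations by parts, proved here in generic form:

* `integral_mul_deriv2_eq_line` — on the line: `∫ U g'' = ∫ U'' g` for `U` of affine growth with bounded `U', U''`
  and `g, g', g''` Gaussian-bounded (twice Mathlib's `integral_mul_deriv_eq_deriv_mul_of_integrable`; no boundary
  terms);
* `intervalIntegral_mul_deriv2_eq_periodic` — over a period: `∫_{−L/2}^{L/2} U g'' = ∫_{−L/2}^{L/2} U'' g` when
  `U, U', g, g'` take equal values at `∓L/2` (twice `intervalIntegral.integral_mul_deriv_eq_deriv_mul`, the boundary
  terms cancelling);
* the second slice derivatives of a `C²` plane field along translated/reflected lines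
  (`hasDerivAt_dY_slice`, `hasDerivAt_dX_slice`) and their Gaussian bounds from bounds on `D²ω`
  (`abs_dY_dY_le`, `abs_dX_dX_le`).
Registered sub-goal proved here: `stub_rowVorticityConstruction_doubleIBPLine`. All `[folklore]`.
-/

set_option linter.dupNamespace false

noncomputable section

open Real Set Filter Topology MeasureTheory
open Literature.Analysis.FluidPDE Literature.Analysis.FluidPDE.StretchedLayer

namespace Summit.AnomalousDissipation.AnomalousDissipation.Theorems.MarginalStabilityChainStretchedVortexRows.RowBiotSavart

/-! ### Double integration by parts on the line -/

section Line

/-- An affine-times-shifted-Gaussian majorant is integrable on the line. [folklore] -/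
theorem integrable_of_abs_le_affine_mul_gauss {F : ℝ → ℝ} (hF : AEStronglyMeasurable F) {A B K b y : ℝ}
    (hb : 0 < b) (hK : 0 ≤ K) (hle : ∀ t, |F t| ≤ (A + B * |t|) * (K * Real.exp (-b * (y - t) ^ 2))) :
    Integrable F := by
  have hi := (integrable_affine_mul_gauss_shift hb (|A| + |B| * |y|) |B| y).const_mul K
  refine hi.mono' hF (Eventually.of_forall fun t => ?_)
  rw [Real.norm_eq_abs]
  refine (hle t).trans ?_
  have ht : |t| ≤ |y| + |y - t| := by
    have := abs_sub_abs_le_abs_sub t y; rw [abs_sub_comm] at this; linarith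
  have he : 0 < Real.exp (-b * (y - t) ^ 2) := Real.exp_pos _
  have h1 : A + B * |t| ≤ |A| + |B| * |y| + |B| * |y - t| := by
    have h2 : B * |t| ≤ |B| * |t| := mul_le_mul_of_nonneg_right (le_abs_self B) (abs_nonneg t)
    nlinarith [le_abs_self A, abs_nonneg B, mul_le_mul_of_nonneg_left ht (abs_nonneg B)]
  calc (A + B * |t|) * (K * Real.exp (-b * (y - t) ^ 2))
      ≤ (|A| + |B| * |y| + |B| * |y - t|) * (K * Real.exp (-b * (y - t) ^ 2)) :=
        mul_le_mul_of_nonneg_right h1 (by positivity)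
    _ = K * ((|A| + |B| * |y| + |B| * |y - t|) * Real.exp (-b * (y - t) ^ 2)) := by ring

/-- **Double integration by parts on the line**: `∫ U g'' = ∫ U'' g` for `U ∈ C²` with `|U| ≤ A + B|t|`,
`|U'| ≤ K₁`, `|U''| ≤ K₂` and `g ∈ C²` with `g, g', g''` bounded by shifted Gaussians. [folklore] -/
theorem integral_mul_deriv2_eq_line {U U' U'' g g' g'' : ℝ → ℝ} (hU : ∀ t, HasDerivAt U (U' t) t)
    (hU' : ∀ t, HasDerivAt U' (U'' t) t) (hg : ∀ t, HasDerivAt g (g' t) t) (hg' : ∀ t, HasDerivAt g' (g'' t) t)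
    (mU'' : AEStronglyMeasurable U'') (mg'' : AEStronglyMeasurable g'') {A B K₁ K₂ C₀ b₀ C₁ b₁ C₂ b₂ y : ℝ}
    (hb₀ : 0 < b₀) (hb₁ : 0 < b₁) (hb₂ : 0 < b₂)
    (bU : ∀ t, |U t| ≤ A + B * |t|) (bU' : ∀ t, |U' t| ≤ K₁) (bU'' : ∀ t, |U'' t| ≤ K₂)
    (bg : ∀ t, |g t| ≤ C₀ * Real.exp (-b₀ * (y - t) ^ 2)) (bg' : ∀ t, |g' t| ≤ C₁ * Real.exp (-b₁ * (y - t) ^ 2))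
    (bg'' : ∀ t, |g'' t| ≤ C₂ * Real.exp (-b₂ * (y - t) ^ 2)) :
    ∫ t, U t * g'' t = ∫ t, U'' t * g t := by
  have cU : Continuous U := continuous_iff_continuousAt.2 fun t => (hU t).continuousAt
  have cU' : Continuous U' := continuous_iff_continuousAt.2 fun t => (hU' t).continuousAt
  have cg : Continuous g := continuous_iff_continuousAt.2 fun t => (hg t).continuousAt
  have cg' : Continuous g' := continuous_iff_continuousAt.2 fun t => (hg' t).continuousAt
  have nn : ∀ {Q : ℝ → ℝ} {K b : ℝ}, (∀ t, |Q t| ≤ K * Real.exp (-b * (y - t) ^ 2)) → 0 ≤ K := by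
    intro Q K b hQ; have := (abs_nonneg _).trans (hQ y); simpa using this
  -- integrability of the five products
  have prod : ∀ {P Q : ℝ → ℝ} {a₀ a₁ K b : ℝ}, AEStronglyMeasurable P → AEStronglyMeasurable Q → 0 < b →
      (∀ t, |P t| ≤ a₀ + a₁ * |t|) → (∀ t, |Q t| ≤ K * Real.exp (-b * (y - t) ^ 2)) → Integrable (P * Q) := by
    intro P Q a₀ a₁ K b mP mQ hb hP hQ
    refine integrable_of_abs_le_affine_mul_gauss (mP.mul mQ) hb (nn hQ) (A := a₀) (B := a₁) (y := y) fun t => ?_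
    rw [Pi.mul_apply, abs_mul]
    exact mul_le_mul (hP t) (hQ t) (abs_nonneg _) ((abs_nonneg _).trans (hP t))
  have bU'a : ∀ t, |U' t| ≤ K₁ + 0 * |t| := fun t => by simpa using bU' t
  have bU''a : ∀ t, |U'' t| ≤ K₂ + 0 * |t| := fun t => by simpa using bU'' t
  have i1 : Integrable (U * g'') := prod cU.aestronglyMeasurable mg'' hb₂ bU bg''
  have i2 : Integrable (U' * g') := prod cU'.aestronglyMeasurable cg'.aestronglyMeasurable hb₁ bU'a bg'
  have i3 : Integrable (U * g') := prod cU.aestronglyMeasurable cg'.aestronglyMeasurable hb₁ bU bg'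
  have i4 : Integrable (U'' * g) := prod mU'' cg.aestronglyMeasurable hb₀ bU''a bg
  have i5 : Integrable (U' * g) := prod cU'.aestronglyMeasurable cg.aestronglyMeasurable hb₀ bU'a bg
  have h1 := integral_mul_deriv_eq_deriv_mul_of_integrable (fun t _ => hU t) (fun t _ => hg' t) i1 i2 i3
  have h2 := integral_mul_deriv_eq_deriv_mul_of_integrable (fun t _ => hU' t) (fun t _ => hg t) i2 i4 i5
  rw [h1, h2, neg_neg]

end Line

/-! ### Double integration by parts over a period -/

/-- **Double integration by parts over a period**: if `U, U'` and `g, g'` take the same values at `−L/2` and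
`L/2` then `∫_{−L/2}^{L/2} U g'' = ∫_{−L/2}^{L/2} U'' g`. [folklore] -/
theorem intervalIntegral_mul_deriv2_eq_periodic {L : ℝ} {U U' U'' g g' g'' : ℝ → ℝ}
    (hU : ∀ s, HasDerivAt U (U' s) s) (hU' : ∀ s, HasDerivAt U' (U'' s) s) (hg : ∀ s, HasDerivAt g (g' s) s)
    (hg' : ∀ s, HasDerivAt g' (g'' s) s) (cU'' : Continuous U'') (cg'' : Continuous g'')
    (pU : U (-(L / 2)) = U (L / 2)) (pU' : U' (-(L / 2)) = U' (L / 2)) (pg : g (-(L / 2)) = g (L / 2))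
    (pg' : g' (-(L / 2)) = g' (L / 2)) :
    ∫ s in -(L / 2)..L / 2, U s * g'' s = ∫ s in -(L / 2)..L / 2, U'' s * g s := by
  have cU' : Continuous U' := continuous_iff_continuousAt.2 fun t => (hU' t).continuousAt
  have cg' : Continuous g' := continuous_iff_continuousAt.2 fun t => (hg' t).continuousAt
  have h1 := intervalIntegral.integral_mul_deriv_eq_deriv_mul (a := -(L / 2)) (b := L / 2)
    (fun s _ => hU s) (fun s _ => hg' s) (cU'.intervalIntegrable _ _) (cg''.intervalIntegrable _ _)
  have h2 := intervalIntegral.integral_mul_deriv_eq_deriv_mul (a := -(L / 2)) (b := L / 2)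
    (fun s _ => hU' s) (fun s _ => hg s) (cU''.intervalIntegrable _ _) (cg'.intervalIntegrable _ _)
  rw [h1, pU, pg', sub_self, zero_sub, h2, pU', pg, sub_self, zero_sub, neg_neg]

/-! ### Second slice derivatives of `C²` fields along lines -/

section Slices2

variable {ω : ℝ → ℝ → ℝ} {C₂ a₂ : ℝ}

/-- `dY ω` of a `C²` field is `C¹` jointly. [folklore] -/
theorem contDiff_one_dY (hω : ContDiff ℝ 2 fun p : ℝ × ℝ => ω p.1 p.2) : ContDiff ℝ 1 fun p : ℝ × ℝ => dY ω p.1 p.2 := by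
  rw [dY_uncurry_eq (hω.of_le one_le_two)]
  exact (hω.fderiv_right le_rfl).clm_apply contDiff_const

/-- `dX ω` of a `C²` field is `C¹` jointly. [folklore] -/
theorem contDiff_one_dX (hω : ContDiff ℝ 2 fun p : ℝ × ℝ => ω p.1 p.2) : ContDiff ℝ 1 fun p : ℝ × ℝ => dX ω p.1 p.2 := by
  rw [dX_uncurry_eq (hω.of_le one_le_two)]
  exact (hω.fderiv_right le_rfl).clm_apply contDiff_const

/-- Second directional slice derivatives of a `C²` field are entries of `D²ω`:
`dY (dY ω) x y = D²ω(x,y)(0,1)(0,1)`. [folklore] -/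
theorem dY_dY_eq (hω : ContDiff ℝ 2 fun p : ℝ × ℝ => ω p.1 p.2) (x y : ℝ) :
    dY (dY ω) x y = (fderiv ℝ (fderiv ℝ fun p : ℝ × ℝ => ω p.1 p.2) (x, y) (0, 1)) (0, 1) := by
  have h1 : ContDiff ℝ 1 fun p : ℝ × ℝ => ω p.1 p.2 := hω.of_le one_le_two
  have hF1 : ContDiff ℝ 1 (fderiv ℝ fun p : ℝ × ℝ => ω p.1 p.2) := hω.fderiv_right le_rfl
  rw [dY_eq_fderiv (contDiff_one_dY hω), dY_uncurry_eq h1]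
  have hd : DifferentiableAt ℝ (fderiv ℝ fun p : ℝ × ℝ => ω p.1 p.2) (x, y) := (hF1.differentiable one_ne_zero) _
  rw [fderiv_clm_apply hd (differentiableAt_const _)]
  simp only [fderiv_fun_const, Pi.zero_apply, ContinuousLinearMap.comp_zero, zero_add,
    ContinuousLinearMap.flip_apply]

/-- `dX (dX ω) x y = D²ω(x,y)(1,0)(1,0)`. [folklore] -/
theorem dX_dX_eq (hω : ContDiff ℝ 2 fun p : ℝ × ℝ => ω p.1 p.2) (x y : ℝ) :
    dX (dX ω) x y = (fderiv ℝ (fderiv ℝ fun p : ℝ × ℝ => ω p.1 p.2) (x, y) (1, 0)) (1, 0) := by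
  have h1 : ContDiff ℝ 1 fun p : ℝ × ℝ => ω p.1 p.2 := hω.of_le one_le_two
  have hF1 : ContDiff ℝ 1 (fderiv ℝ fun p : ℝ × ℝ => ω p.1 p.2) := hω.fderiv_right le_rfl
  rw [dX_eq_fderiv (contDiff_one_dX hω), dX_uncurry_eq h1]
  have hd : DifferentiableAt ℝ (fderiv ℝ fun p : ℝ × ℝ => ω p.1 p.2) (x, y) := (hF1.differentiable one_ne_zero) _
  rw [fderiv_clm_apply hd (differentiableAt_const _)]
  simp only [fderiv_fun_const, Pi.zero_apply, ContinuousLinearMap.comp_zero, zero_add,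
    ContinuousLinearMap.flip_apply]

/-- `‖D(Dω)(p)‖ = ‖D²ω(p)‖` (iterated-derivative norm). [folklore] -/
theorem norm_fderiv_fderiv_eq (p : ℝ × ℝ) :
    ‖fderiv ℝ (fderiv ℝ fun p : ℝ × ℝ => ω p.1 p.2) p‖ = ‖iteratedFDeriv ℝ 2 (fun p : ℝ × ℝ => ω p.1 p.2) p‖ := by
  rw [← norm_iteratedFDeriv_zero (𝕜 := ℝ) (f := fderiv ℝ (fderiv ℝ fun p : ℝ × ℝ => ω p.1 p.2)),
    norm_iteratedFDeriv_fderiv, norm_iteratedFDeriv_fderiv]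

/-- A Gaussian bound on `D²ω` bounds `dY (dY ω)`. [folklore] -/
theorem abs_dY_dY_le (hω : ContDiff ℝ 2 fun p : ℝ × ℝ => ω p.1 p.2)
    (hb₂ : ∀ p, ‖iteratedFDeriv ℝ 2 (fun p : ℝ × ℝ => ω p.1 p.2) p‖ ≤ C₂ * Real.exp (-a₂ * p.2 ^ 2)) (x y : ℝ) :
    |dY (dY ω) x y| ≤ C₂ * Real.exp (-a₂ * y ^ 2) := by
  rw [dY_dY_eq hω, ← Real.norm_eq_abs]
  set A := fderiv ℝ (fderiv ℝ fun p : ℝ × ℝ => ω p.1 p.2) (x, y)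
  have h1 : ‖A (0, 1)‖ ≤ ‖A‖ := by
    refine (A.le_opNorm _).trans ?_; simp [Prod.norm_def]
  have h2 : ‖A (0, 1) (0, 1)‖ ≤ ‖A (0, 1)‖ := by
    refine ((A (0, 1)).le_opNorm _).trans ?_; simp [Prod.norm_def]
  have h3 : ‖A‖ ≤ C₂ * Real.exp (-a₂ * y ^ 2) := by rw [norm_fderiv_fderiv_eq]; exact hb₂ (x, y)
  linarith

/-- A Gaussian bound on `D²ω` bounds `dX (dX ω)`. [folklore] -/
theorem abs_dX_dX_le (hω : ContDiff ℝ 2 fun p : ℝ × ℝ => ω p.1 p.2)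
    (hb₂ : ∀ p, ‖iteratedFDeriv ℝ 2 (fun p : ℝ × ℝ => ω p.1 p.2) p‖ ≤ C₂ * Real.exp (-a₂ * p.2 ^ 2)) (x y : ℝ) :
    |dX (dX ω) x y| ≤ C₂ * Real.exp (-a₂ * y ^ 2) := by
  rw [dX_dX_eq hω, ← Real.norm_eq_abs]
  set A := fderiv ℝ (fderiv ℝ fun p : ℝ × ℝ => ω p.1 p.2) (x, y)
  have h1 : ‖A (1, 0)‖ ≤ ‖A‖ := by
    refine (A.le_opNorm _).trans ?_; simp [Prod.norm_def]
  have h2 : ‖A (1, 0) (1, 0)‖ ≤ ‖A (1, 0)‖ := by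
    refine ((A (1, 0)).le_opNorm _).trans ?_; simp [Prod.norm_def]
  have h3 : ‖A‖ ≤ C₂ * Real.exp (-a₂ * y ^ 2) := by rw [norm_fderiv_fderiv_eq]; exact hb₂ (x, y)
  linarith

/-- Along a reflected line `t ↦ ω(x₀, y − t)`: the derivative of `t ↦ −(dY ω)(x₀, y − t)` is
`(dY (dY ω))(x₀, y − t)`. [folklore] -/
theorem hasDerivAt_dY_slice (hω : ContDiff ℝ 2 fun p : ℝ × ℝ => ω p.1 p.2) (x₀ y t : ℝ) :
    HasDerivAt (fun t => -dY ω x₀ (y - t)) (dY (dY ω) x₀ (y - t)) t := by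
  have h := HasDerivAt.comp_const_sub y t (hasDerivAt_slice_snd (contDiff_one_dY hω) x₀ (y - t))
  have h2 : HasDerivAt (fun t => -dY ω x₀ (y - t)) (-(-dY (dY ω) x₀ (y - t))) t := h.neg
  exact h2.congr_deriv (neg_neg _)

/-- Along a reflected line `s ↦ ω(x − s, y₀)`: the derivative of `s ↦ −(dX ω)(x − s, y₀)` is
`(dX (dX ω))(x − s, y₀)`. [folklore] -/
theorem hasDerivAt_dX_slice (hω : ContDiff ℝ 2 fun p : ℝ × ℝ => ω p.1 p.2) (x y₀ s : ℝ) :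
    HasDerivAt (fun s => -dX ω (x - s) y₀) (dX (dX ω) (x - s) y₀) s := by
  have h := HasDerivAt.comp_const_sub x s (hasDerivAt_slice_fst (contDiff_one_dX hω) (x - s) y₀)
  have h2 : HasDerivAt (fun s => -dX ω (x - s) y₀) (-(-dX (dX ω) (x - s) y₀)) s := h.neg
  exact h2.congr_deriv (neg_neg _)

end Slices2

end RowBiotSavart

open RowBiotSavart in
/-- **Double integration by parts on a line, no boundary terms** (registered on stmt-AnomalousDissipation-3009 as
the helper stub `stub_rowVorticityConstruction_doubleIBPLine` of `stub_rowVorticityConstruction`): for `U ∈ C²(ℝ)`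
of affine growth with bounded `U', U''` (the regularised kernel along a line of the strip) and `g ∈ C²(ℝ)` with
`g, g', g''` bounded by a shifted Gaussian (the vorticity along that line), `∫ U g'' = ∫ U'' g` — the
one-dimensional content of Green's second identity on the strip (`RowBiotSavart.integral_mul_deriv2_eq_line`).
[folklore] -/
theorem stub_rowVorticityConstruction_doubleIBPLine :
    ∀ (U U' U'' g g' g'' : ℝ → ℝ) (A B K₁ K₂ C₀ b₀ C₁ b₁ C₂ b₂ y : ℝ), (∀ t, HasDerivAt U (U' t) t) →
      (∀ t, HasDerivAt U' (U'' t) t) → (∀ t, HasDerivAt g (g' t) t) → (∀ t, HasDerivAt g' (g'' t) t) →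
      MeasureTheory.AEStronglyMeasurable U'' MeasureTheory.volume →
      MeasureTheory.AEStronglyMeasurable g'' MeasureTheory.volume → 0 < b₀ → 0 < b₁ → 0 < b₂ →
      (∀ t, |U t| ≤ A + B * |t|) → (∀ t, |U' t| ≤ K₁) → (∀ t, |U'' t| ≤ K₂) →
      (∀ t, |g t| ≤ C₀ * Real.exp (-b₀ * (y - t) ^ 2)) → (∀ t, |g' t| ≤ C₁ * Real.exp (-b₁ * (y - t) ^ 2)) →
      (∀ t, |g'' t| ≤ C₂ * Real.exp (-b₂ * (y - t) ^ 2)) →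
      ∫ t, U t * g'' t = ∫ t, U'' t * g t :=
  fun _ _ _ _ _ _ _ _ _ _ _ _ _ _ _ _ _ hU hU' hg hg' mU'' mg'' hb₀ hb₁ hb₂ bU bU' bU'' bg bg' bg'' =>
    integral_mul_deriv2_eq_line hU hU' hg hg' mU'' mg'' hb₀ hb₁ hb₂ bU bU' bU'' bg bg' bg''

end Summit.AnomalousDissipation.AnomalousDissipation.Theorems.MarginalStabilityChainStretchedVortexRows

end
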